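import Literature.MathematicalPhysics.QuantumFieldTheory.Balaban1983to89.B7Prop3FlatRecSide

/-!
# `Balaban1983to89.B7Prop3FlatRec` — [Balaban1985Averaging] Prop. 3 at `V₀ = 1`, (110)–(112), (120)–(123), (125) pp. 34–36 FOR THE RECORD's AVERAGING
# STRUCTURE ([Balaban1987RG1] (0.3)–(0.4)): the frame estimate for the centred single-staircase frames, the DOUBLE-BAR estimate and the first-order
# Taylor term of `(1∕i) log V̿₁(c)` — which is `L·(Q₀A)_c + Φ(c₋) − Φ(c₊)`, NOT `L·(Q₀A)_c` (LOCATED-N2; Φ = `B7Prop3FlatRecSide.PhiZ`, the curvature functional)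

statement-level skeleton of published theorems with citation tags; proofs where landed; nothing here is a claim about the Yang–Mills mass gap

CITATION HEADER (lean-in-tree rule).  Cell `pub-ymgap`, seat `pub-ymgap-dag-n05-e` g35 (N05-REC LEAD PEN; director-ym №257 = road (A′) for LOCATED-N2); item R1 ∕ N2 of the
road — the FLAT half of Prop. 3 for the record structure, part 2.  `--kind proof --supports stmt-QuantumFields-20541` (K0⁷; count-neutral).  Sources READ: [3]
pp. 34–36 (`paper:balaban1985-cmp98-averaging`) through the engine module `B7Prop3Flat` (`frame_estimate`, `dbavg_estimate`, `mlog_dbavg_sub_linQ_le_of_bound`,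
`mlog_dbavg_zero`, `hasDerivAt_mlog_dbavg_ray`), whose proofs are re-run here over the record objects with the constants the wider first-order term forces
(`3θ` for the side, `231θ² ∕ 9θ ∕ 555θ²` for the double bar; the engine: `2θ`, `214θ² ∕ 5θ ∕ 314θ²`); [I] (0.3)–(0.4) pp. 252–253 (`paper:balaban1987-cmp109-rg-i-small-field`).

WHAT IS PROVED (sorry-free; no definition).
* §1 `frame_estimateZ` — (111)–(112) for the centred single-staircase frames `FavgZ ∕ FhatZ ∕ vframeZ` (`4θ, 17θ², θ, 8θ, 33θ²`; token re-run of `B7Prop3Flat.frame_estimate`).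
* §2 `norm_SZ_le`, `norm_PhiZ_le_two` (the crude size `‖Φ‖ ≤ 2θ` — NOT the curvature bound N2, which is finer), `linZ_smul`; ★ `dbavgZ_estimate` — (120)–(123) for the
  record: `‖V̿₁(c) − 1 − ℓ_c‖ ≤ 231θ²`, `‖V̿₁(c) − 1‖ ≤ 9θ`, `‖log V̿₁(c) − ℓ_c‖ ≤ 555θ²` with **`ℓ_c := L·(Q₀A)_c + Φ(c₋) − Φ(c₊)`** (`linZ`).
* §3 `mlog_dbavgZ_sub_linZ_le_of_bound` (along a ray), `mlog_dbavgZ_zero`, ★★ `hasDerivAt_mlog_dbavgZ_ray` — **(122) for the typed record: the first-order Taylor term of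
  `t ↦ (1∕i) log V̿₁(c)[e^{tA}]` at `0` is `ℓ_c = L·(Q₀A)_c + Φ(c₋) − Φ(c₊)`** — the exact statement behind LOCATED-N2 (the engine's `hasDerivAt_mlog_dbavg_ray` has `L·(Q₀A)_c`).
HONEST SCOPE.  Second-order estimates re-run from the engine + the located first-order identity, kernel-checked for OUR typed objects; NO bound of Φ by the curl (N2's
estimate, next); nothing of [3]∕[6]∕[I] asserted beyond these computations; `HThm4Rec` UNDISCHARGED; N05 ∕ N07 NOT discharged; counts unmoved (typed 28∕28 · discharged
7∕28); one finite 𝕋⁴ programme at fixed ε — nothing continuum ∕ ℝ⁴ ∕ OS ∕ mass gap ∕ Clay.  No `def`, no `instance`, no `notation`, no `sorry`.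
-/

set_option autoImplicit false

noncomputable section

open scoped BigOperators
open NormedSpace

namespace Literature.MathematicalPhysics.QuantumFieldTheory.Balaban1983to89.B7Prop3FlatRec

open B7Prop1Explicit hiding Site
open B7Prop1Explicit renaming Site → SiteZ
open MatrixLog
open B7Prop3Flat (expCfg asum_smul)
open BlockAveragingZd (offZ offZ_apply IdxZ WZ WZ_def XZ bavgZ length_loopWord)
open B7SectEFLinearisationRec (FhatZ FavgZ vframeZ dbavgZ linQZ)
open B7Prop3FlatRecSide
open T4Continuum (stairWord loopWord)

variable {d : ℕ}

section Estimates

variable {𝔸 : Type*} [NormedRing 𝔸] [NormedAlgebra ℂ 𝔸] [CompleteSpace 𝔸]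

/-! ## §1 The frame estimate (111)–(112) for the centred single-staircase frames -/

/-- (RECORD TWIN of `B7Prop3Flat.frame_estimate`: the frame words run from the CENTRE to the CENTRED block points, `treeWord (offZ L r)`; proof token-identical.) **(111)–(112) at `V₀ = 1`, quantitatively.**  In the region (an `l¹`-ball of radius `R` about `y` containing `B(q)`)
where `V_b = e^{A_b}`, `|A_b| ≤ a`, and with `dL·a ≤ θ ≤ 1/64` (`dL ≥ |Γ_{y,x}|`): `|F(q)| ≤ 4θ`,
`|F(q) − F̂(q)| ≤ 17θ²` ((111) averaged: `16θ²` from `log W − (W − 1)` via (26), `θ²` from `V₁(Γ) − 1 − A(Γ)`),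
`|F̂(q)| ≤ θ`; and for the frame `v(q) = e^{F(q)}` ((112)): `|v(q) − 1| ≤ 8θ`, `|v(q) − 1 − F̂(q)| ≤ 33θ²`, the same for
`v(q)⁻¹ = e^{−F(q)}` with `−F̂(q)`.  Print: "`\overline{R_{0,y}V₁} = exp[i Σ L^{−d}(R_{0,y}A)(Γ_{y,x}) + O(L²α₁²)]`" —
here `O(L²α₁²) = 17θ²`, `θ = (2d+2)L·a` downstream. [cite: Balaban1985Averaging, (111)–(112) p.34] -/
theorem frame_estimateZ (V : SiteZ d → Fin d → 𝔸ˣ) (A : SiteZ d → Fin d → 𝔸) (y : SiteZ d) (R : ℕ) {a θ : ℝ}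
    (ha : 0 ≤ a) (hVA : ∀ x κ, l1 (x - y) ≤ R → ((V x κ : 𝔸ˣ) : 𝔸) = exp (A x κ) ∧ ‖A x κ‖ ≤ a)
    (L : ℕ) (hL : 1 ≤ L) (q : SiteZ d) (hR : l1 (q - y) + d * L ≤ R)
    (hθ : ((d * L : ℕ) : ℝ) * a ≤ θ) (hθ0 : 0 ≤ θ) (hθ1 : θ ≤ 1 / 64) :
    ‖FavgZ L V q‖ ≤ 4 * θ ∧ ‖FavgZ L V q - FhatZ L A q‖ ≤ 17 * θ ^ 2 ∧ ‖FhatZ L A q‖ ≤ θ ∧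
    ‖((vframeZ L V q : 𝔸ˣ) : 𝔸) - 1‖ ≤ 8 * θ ∧
    ‖((vframeZ L V q : 𝔸ˣ) : 𝔸) - 1 - FhatZ L A q‖ ≤ 33 * θ ^ 2 ∧
    ‖(((vframeZ L V q)⁻¹ : 𝔸ˣ) : 𝔸) - 1‖ ≤ 8 * θ ∧
    ‖(((vframeZ L V q)⁻¹ : 𝔸ˣ) : 𝔸) - 1 - (-FhatZ L A q)‖ ≤ 33 * θ ^ 2 := by
  have hA : ∀ x κ, l1 (x - y) ≤ R → ‖A x κ‖ ≤ a := fun x κ hx => (hVA x κ hx).2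
  have hNa : ∀ n : ℕ, n ≤ d * L → (n : ℝ) * a ≤ θ := fun n hn =>
    (mul_le_mul_of_nonneg_right (by exact_mod_cast hn) ha).trans hθ
  -- (111) at `V₀ = 1`: `(1/i) log V₁(Γ_{y,x}) = A(Γ_{y,x}) + O((|A|(Γ_{y,x}))²)` along each tree contour
  have htree : ∀ r : Fin d → Fin L,
      ‖mlog ((hol V q (treeWord (offZ L r)) : 𝔸ˣ) : 𝔸)‖ ≤ 4 * θ ∧
      ‖mlog ((hol V q (treeWord (offZ L r)) : 𝔸ˣ) : 𝔸) - asum A q (treeWord (offZ L r))‖ ≤ 17 * θ ^ 2 ∧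
      ‖asum A q (treeWord (offZ L r))‖ ≤ θ := by
    intro r
    have hlen : (treeWord (offZ L r)).length ≤ d * L := by
      rw [length_treeWord]; exact l1_offZ_le_dL L r
    obtain ⟨h1, h2⟩ := walk_linear V A y R ha hVA (treeWord (offZ L r)) q (by omega)
    have hna := hNa _ hlen
    have hW : ‖((hol V q (treeWord (offZ L r)) : 𝔸ˣ) : 𝔸) - 1‖ ≤ 2 * θ :=
      h1.trans (exp_sub_one_le_of_le hna hθ0 hθ1)
    have hW' : ‖((hol V q (treeWord (offZ L r)) : 𝔸ˣ) : 𝔸) - 1‖ ≤ 1 / 2 := hW.trans (by linarith)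
    refine ⟨(norm_mlog_le_two_mul hW').trans (by linarith), ?_,
      (norm_asum_le A y R ha hA _ q (by omega)).trans hna⟩
    have h3 := norm_mlog_sub_le hW'
    have h4 : expRem (2 * ‖((hol V q (treeWord (offZ L r)) : 𝔸ˣ) : 𝔸) - 1‖) ≤ 16 * θ ^ 2 :=
      (expRem_mono (by positivity) (by linarith)).trans (expRem4_le hθ0 hθ1)
    have h5 := expRem_le_sq_of_le (by positivity) hna hθ0 hθ1
    calc _ = ‖(mlog ((hol V q (treeWord (offZ L r)) : 𝔸ˣ) : 𝔸)
              - (((hol V q (treeWord (offZ L r)) : 𝔸ˣ) : 𝔸) - 1))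
            + ((((hol V q (treeWord (offZ L r)) : 𝔸ˣ) : 𝔸) - 1) - asum A q (treeWord (offZ L r)))‖ := by
            rw [sub_add_sub_cancel]
      _ ≤ _ := norm_add_le _ _
      _ ≤ 16 * θ ^ 2 + θ ^ 2 := add_le_add (h3.trans h4) (h2.trans h5)
      _ = 17 * θ ^ 2 := by ring
  -- the block averages (110)/(112)
  have hFn : ‖FavgZ L V q‖ ≤ 4 * θ := norm_avg_le L hL _ fun r => (htree r).1
  have hFF : ‖FavgZ L V q - FhatZ L A q‖ ≤ 17 * θ ^ 2 := by
    rw [FavgZ, FhatZ, ← Finset.sum_sub_distrib]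
    simp_rw [← smul_sub]
    exact norm_avg_le L hL _ fun r => (htree r).2.1
  have hFh : ‖FhatZ L A q‖ ≤ θ := norm_avg_le L hL _ fun r => (htree r).2.2
  have hFF' : ‖-FavgZ L V q - -FhatZ L A q‖ ≤ 17 * θ ^ 2 := by rwa [← neg_sub', norm_neg]
  -- the exponentials `v(y) = e^{F(y)}`, `v(y)⁻¹ = e^{−F(y)}`
  obtain ⟨hE1, hE2⟩ := norm_exp_sub_one_le_of_norm_le hFn
  obtain ⟨hE1', hE2'⟩ := norm_exp_sub_one_le_of_norm_le (show ‖-FavgZ L V q‖ ≤ 4 * θ by rwa [norm_neg])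
  have hv : ((vframeZ L V q : 𝔸ˣ) : 𝔸) = exp (FavgZ L V q) := rfl
  have hvi : (((vframeZ L V q)⁻¹ : 𝔸ˣ) : 𝔸) = exp (-FavgZ L V q) := by
    rw [vframeZ, val_inv_expUnit, val_expUnit]
  refine ⟨hFn, hFF, hFh, ?_, ?_, ?_, ?_⟩
  · rw [hv]; exact hE1.trans (exp4_sub_one_le hθ0 hθ1)
  · rw [hv]
    calc _ = ‖(exp (FavgZ L V q) - 1 - FavgZ L V q) + (FavgZ L V q - FhatZ L A q)‖ := by rw [sub_add_sub_cancel]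
      _ ≤ _ := norm_add_le _ _
      _ ≤ 16 * θ ^ 2 + 17 * θ ^ 2 := add_le_add (hE2.trans (expRem4_le hθ0 hθ1)) hFF
      _ = 33 * θ ^ 2 := by ring
  · rw [hvi]; exact hE1'.trans (exp4_sub_one_le hθ0 hθ1)
  · rw [hvi]
    calc _ = ‖(exp (-FavgZ L V q) - 1 - -FavgZ L V q) + (-FavgZ L V q - -FhatZ L A q)‖ := by
            rw [sub_add_sub_cancel]
      _ ≤ _ := norm_add_le _ _
      _ ≤ 16 * θ ^ 2 + 17 * θ ^ 2 := add_le_add (hE2'.trans (expRem4_le hθ0 hθ1)) hFF'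
      _ = 33 * θ ^ 2 := by ring

/-! ## §2 The double-bar estimate (120)–(123) with the curvature functional -/

omit [CompleteSpace 𝔸] in
/-- `‖SZ(q)[A]‖ ≤ dL·a` in the region of control: each staircase has `|n|₁ ≤ dL` bonds. [cite: Balaban1987RG1, (0.3) p.252; Balaban1985Averaging, (126) p.36] -/
theorem norm_SZ_le (A : SiteZ d → Fin d → 𝔸) (y : SiteZ d) (R : ℕ) {a : ℝ} (ha : 0 ≤ a)
    (hA : ∀ x κ, l1 (x - y) ≤ R → ‖A x κ‖ ≤ a) (L : ℕ) (hL : 1 ≤ L) (q : SiteZ d) (hR : l1 (q - y) + d * L ≤ R) :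
    ‖SZ L A q‖ ≤ ((d * L : ℕ) : ℝ) * a := by
  refine norm_avgZ_le L hL _ fun i => ?_
  have hlen : (stairWord i.2.1 (offZ L i.1)).length ≤ d * L := by
    rw [BlockAveragingZd.length_stairWord]; exact l1_offZ_le_dL L i.1
  exact (norm_asum_le A y R ha hA _ q (by omega)).trans
    (mul_le_mul_of_nonneg_right (by exact_mod_cast hlen) ha)

omit [CompleteSpace 𝔸] in
/-- The first-order term is a LINEAR form in `A`: `ℓ_c[tA] = t·ℓ_c[A]` (`ℓ_c = L·(Q₀A)_c + Φ(c₋) − Φ(c₊)`). [cite: Balaban1985Averaging, (122) p.36] -/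
theorem linZ_smul (L : ℕ) (t : ℝ) (A : SiteZ d → Fin d → 𝔸) (q : SiteZ d) (κ : Fin d) :
    linQZ L (t • A) q κ + PhiZ L (t • A) q - PhiZ L (t • A) (q + (L : ℤ) • e κ)
      = t • (linQZ L A q κ + PhiZ L A q - PhiZ L A (q + (L : ℤ) • e κ)) := by
  simp only [linQZ, PhiZ, SZ, FhatZ, asum_smul, Finset.smul_sum, smul_sub, smul_add, smul_comm t]

/-- ★ **(120)–(123) at `V₀ = 1` FOR THE TYPED RECORD.**  In the region (radius `R ≥ |c₋ − y|₁ + (2d+2)L` about `y`) where `V_b = e^{A_b}`, `|A_b| ≤ a`, with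
`(2d+2)L·a ≤ θ ≤ 1∕64`: with `ℓ_c := L·(Q₀A)_c + Φ(c₋) − Φ(c₊)`, `‖V̿₁(c) − 1 − ℓ_c‖ ≤ 231θ²` (three factors within `8θ, 3θ, 8θ` of `1`, first-order terms
`−F̂Z(c₋), TZ_c, F̂Z(c₊)` with remainders `33θ², 50θ², 33θ²`, summed by `frame_cancellationZ`), `‖V̿₁(c) − 1‖ ≤ 9θ`, `‖log V̿₁(c) − ℓ_c‖ ≤ 555θ²`.  The engine's
`B7Prop3Flat.dbavg_estimate` is the case Φ ≡ 0 (constants `214θ², 5θ, 314θ²`). [cite: Balaban1985Averaging, (120) p.35, (121)–(123) p.36; Balaban1987RG1, (0.4) p.253] -/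
theorem dbavgZ_estimate (V : SiteZ d → Fin d → 𝔸ˣ) (A : SiteZ d → Fin d → 𝔸) (y : SiteZ d) (R : ℕ) {a θ : ℝ}
    (ha : 0 ≤ a) (hVA : ∀ x κ, l1 (x - y) ≤ R → ((V x κ : 𝔸ˣ) : 𝔸) = exp (A x κ) ∧ ‖A x κ‖ ≤ a)
    (L : ℕ) (hL : 1 ≤ L) (q : SiteZ d) (κ : Fin d) (hR : l1 (q - y) + (2 * (d * L) + L + L) ≤ R)
    (hθ : ((2 * (d * L) + L + L : ℕ) : ℝ) * a ≤ θ) (hθ0 : 0 ≤ θ) (hθ1 : θ ≤ 1 / 64) :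
    ‖((dbavgZ L V q κ : 𝔸ˣ) : 𝔸) - 1 - (linQZ L A q κ + PhiZ L A q - PhiZ L A (q + (L : ℤ) • e κ))‖ ≤ 231 * θ ^ 2 ∧
    ‖((dbavgZ L V q κ : 𝔸ˣ) : 𝔸) - 1‖ ≤ 9 * θ ∧
    ‖mlog ((dbavgZ L V q κ : 𝔸ˣ) : 𝔸) - (linQZ L A q κ + PhiZ L A q - PhiZ L A (q + (L : ℤ) • e κ))‖ ≤ 555 * θ ^ 2 := by
  have hA : ∀ x κ, l1 (x - y) ≤ R → ‖A x κ‖ ≤ a := fun x κ hx => (hVA x κ hx).2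
  have hNa : ∀ n : ℕ, n ≤ 2 * (d * L) + L + L → (n : ℝ) * a ≤ θ := fun n hn =>
    (mul_le_mul_of_nonneg_right (by exact_mod_cast hn) ha).trans hθ
  have hθd : ((d * L : ℕ) : ℝ) * a ≤ θ := hNa _ (by omega)
  -- the three factors
  obtain ⟨-, -, hFh1, -, -, h1φ, h1δ⟩ := frame_estimateZ V A y R ha hVA L hL q (by omega) hθd hθ0 hθ1
  obtain ⟨h2φ, h2δ, -, -, -⟩ := side_estimateZ V A y R ha hVA L hL q κ hR hθ hθ0 hθ1
  have hR' : l1 (q + (L : ℤ) • e κ - y) + d * L ≤ R := by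
    have := l1_add_le (q - y) ((L : ℤ) • e κ)
    rw [l1_zsmul_e, Int.natAbs_natCast, show q - y + (L : ℤ) • e κ = q + (L : ℤ) • e κ - y by abel] at this
    omega
  obtain ⟨-, -, hFh3, h3φ, h3δ, -, -⟩ := frame_estimateZ V A y R ha hVA L hL (q + (L : ℤ) • e κ) hR' hθd hθ0 hθ1
  set F₁ : 𝔸 := (((vframeZ L V q)⁻¹ : 𝔸ˣ) : 𝔸) with hF₁
  set F₂ : 𝔸 := ((bavgZ L V q κ : 𝔸ˣ) : 𝔸) with hF₂
  set F₃ : 𝔸 := ((vframeZ L V (q + (L : ℤ) • e κ) : 𝔸ˣ) : 𝔸) with hF₃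
  set t₁ : 𝔸 := -FhatZ L A q with ht₁
  set t₂ : 𝔸 := TsideZ L A q κ with ht₂
  set t₃ : 𝔸 := FhatZ L A (q + (L : ℤ) • e κ) with ht₃
  have hD : ((dbavgZ L V q κ : 𝔸ˣ) : 𝔸) = F₁ * F₂ * F₃ := by
    simp only [dbavgZ, Units.val_mul, hF₁, hF₂, hF₃]
  -- two factors
  have g2 : ‖F₁ * F₂ - 1‖ ≤ 11 * θ + 24 * θ ^ 2 := by
    refine (B7Prop6Bound.mul_sub_one_norm_le _ _).trans ?_
    nlinarith [norm_nonneg (F₁ - 1), norm_nonneg (F₂ - 1), mul_le_mul h1φ h2φ (norm_nonneg _) (by positivity)]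
  have e2 : ‖F₁ * F₂ - 1 - (t₁ + t₂)‖ ≤ 107 * θ ^ 2 := by
    refine (norm_mul_sub_one_sub_le _ _ _ _).trans ?_
    nlinarith [mul_le_mul h1φ h2φ (norm_nonneg _) (by positivity)]
  -- three factors
  have e3 : ‖F₁ * F₂ * F₃ - 1 - (t₁ + t₂ + t₃)‖ ≤ 231 * θ ^ 2 := by
    refine (norm_mul_sub_one_sub_le _ _ _ _).trans ?_
    have h10 : (0 : ℝ) ≤ 11 * θ + 24 * θ ^ 2 := by positivity
    have := mul_le_mul g2 h3φ (norm_nonneg _) h10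
    nlinarith
  have hlin : t₁ + t₂ + t₃ = linQZ L A q κ + PhiZ L A q - PhiZ L A (q + (L : ℤ) • e κ) := frame_cancellationZ L hL A q κ
  rw [hlin] at e3
  -- the size of the first-order term: `θ + 2θ + 2θ`
  have hQ0 : ‖linQZ L A q κ‖ ≤ θ := by
    refine (norm_linQZ_le A y R ha hA L hL q κ (by omega)).trans ?_
    exact (mul_le_mul_of_nonneg_right (by exact_mod_cast (by omega : L ≤ 2 * (d * L) + L + L)) ha).trans hθ
  have hS1 : ‖SZ L A q‖ ≤ θ := (norm_SZ_le A y R ha hA L hL q (by omega)).trans hθd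
  have hS3 : ‖SZ L A (q + (L : ℤ) • e κ)‖ ≤ θ := (norm_SZ_le A y R ha hA L hL _ hR').trans hθd
  have hP1 : ‖PhiZ L A q‖ ≤ 2 * θ := by
    unfold PhiZ; exact (norm_sub_le _ _).trans (by linarith)
  have hP3 : ‖PhiZ L A (q + (L : ℤ) • e κ)‖ ≤ 2 * θ := by
    unfold PhiZ; exact (norm_sub_le _ _).trans (by linarith)
  have hQ : ‖linQZ L A q κ + PhiZ L A q - PhiZ L A (q + (L : ℤ) • e κ)‖ ≤ 5 * θ := by
    calc _ ≤ ‖linQZ L A q κ + PhiZ L A q‖ + ‖PhiZ L A (q + (L : ℤ) • e κ)‖ := norm_sub_le _ _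
      _ ≤ ‖linQZ L A q κ‖ + ‖PhiZ L A q‖ + ‖PhiZ L A (q + (L : ℤ) • e κ)‖ := by gcongr; exact norm_add_le _ _
      _ ≤ 5 * θ := by linarith
  have hD1 : ‖F₁ * F₂ * F₃ - 1‖ ≤ 9 * θ := by
    calc ‖F₁ * F₂ * F₃ - 1‖
        = ‖(F₁ * F₂ * F₃ - 1 - (linQZ L A q κ + PhiZ L A q - PhiZ L A (q + (L : ℤ) • e κ)))
            + (linQZ L A q κ + PhiZ L A q - PhiZ L A (q + (L : ℤ) • e κ))‖ := by rw [sub_add_cancel]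
      _ ≤ 231 * θ ^ 2 + 5 * θ := (norm_add_le _ _).trans (add_le_add e3 hQ)
      _ ≤ 9 * θ := by nlinarith
  refine ⟨by rw [hD]; exact e3, by rw [hD]; exact hD1, ?_⟩
  rw [hD]
  have hD1' : ‖F₁ * F₂ * F₃ - 1‖ ≤ 1 / 2 := hD1.trans (by linarith)
  have hlog := norm_mlog_sub_le hD1'
  have hrem : expRem (2 * ‖F₁ * F₂ * F₃ - 1‖) ≤ 324 * θ ^ 2 := by
    refine (expRem_mono (by positivity) (show 2 * ‖F₁ * F₂ * F₃ - 1‖ ≤ 18 * θ by linarith)).trans ?_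
    have := expRem_le_sq (by positivity : (0 : ℝ) ≤ 18 * θ) (by linarith)
    nlinarith
  calc _ = ‖(mlog (F₁ * F₂ * F₃) - (F₁ * F₂ * F₃ - 1))
            + (F₁ * F₂ * F₃ - 1 - (linQZ L A q κ + PhiZ L A q - PhiZ L A (q + (L : ℤ) • e κ)))‖ := by
          rw [sub_add_sub_cancel]
    _ ≤ _ := norm_add_le _ _
    _ ≤ 324 * θ ^ 2 + 231 * θ ^ 2 := add_le_add (hlog.trans hrem) e3
    _ = 555 * θ ^ 2 := by ring

/-! ## §3 Along a ray: (122)–(123) and the first-order Taylor term (122) of the typed record -/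

/-- (122)–(123) at `V₀ = 1` ALONG A RAY for the record: for `|A_b| ≤ M` and `V₁ = e^{tA}`, `‖log V̿₁(c) − t·ℓ_c‖ ≤ 555((2d+2)L·M)²·t²` whenever `(2d+2)L·M·|t| ≤ 1∕64`.
[cite: Balaban1985Averaging, (122)–(123) p.36; Balaban1987RG1, (0.4) p.253] -/
theorem mlog_dbavgZ_sub_linZ_le_of_bound (A : SiteZ d → Fin d → 𝔸) {M : ℝ} (hM0 : 0 ≤ M) (hM : ∀ x κ, ‖A x κ‖ ≤ M)
    (L : ℕ) (hL : 1 ≤ L) (q : SiteZ d) (κ : Fin d) (t : ℝ)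
    (ht : ((2 * (d * L) + L + L : ℕ) : ℝ) * (M * |t|) ≤ 1 / 64) :
    ‖mlog ((dbavgZ L (expCfg (t • A)) q κ : 𝔸ˣ) : 𝔸)
        - t • (linQZ L A q κ + PhiZ L A q - PhiZ L A (q + (L : ℤ) • e κ))‖
      ≤ 555 * (((2 * (d * L) + L + L : ℕ) : ℝ) * M) ^ 2 * t ^ 2 := by
  have hVA : ∀ x κ', l1 (x - q) ≤ 2 * (d * L) + L + L →
      (((expCfg (t • A)) x κ' : 𝔸ˣ) : 𝔸) = exp ((t • A) x κ') ∧ ‖(t • A) x κ'‖ ≤ M * |t| := by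
    intro x κ' _
    refine ⟨rfl, ?_⟩
    rw [Pi.smul_apply, Pi.smul_apply, norm_smul, Real.norm_eq_abs, mul_comm]
    exact mul_le_mul_of_nonneg_right (hM x κ') (abs_nonneg t)
  obtain ⟨-, -, h⟩ := dbavgZ_estimate (expCfg (t • A)) (t • A) q (2 * (d * L) + L + L) (by positivity) hVA L hL
    q κ (by simp [l1]) le_rfl (by positivity) ht
  rw [linZ_smul] at h
  refine h.trans (le_of_eq ?_)
  rw [mul_pow, mul_pow, sq_abs]; ring

/-- At `A = 0`: `log V̿₁(c) = 0` for the record too (no constant Taylor term). [cite: Balaban1985Averaging, p.36 (after (121))] -/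
theorem mlog_dbavgZ_zero (L : ℕ) (hL : 1 ≤ L) (q : SiteZ d) (κ : Fin d) :
    mlog ((dbavgZ L (expCfg (0 : SiteZ d → Fin d → 𝔸)) q κ : 𝔸ˣ) : 𝔸) = 0 := by
  have h := mlog_dbavgZ_sub_linZ_le_of_bound (0 : SiteZ d → Fin d → 𝔸) le_rfl (fun x κ => by simp) L hL q κ 0
    (by simp)
  simp only [zero_smul, sub_zero, mul_zero, norm_le_zero_iff, sq] at h
  simpa using h

/-- ★★ **(122) FOR THE TYPED RECORD — THE FIRST-ORDER TAYLOR TERM IS `L·(Q₀A)_c + Φ(c₋) − Φ(c₊)`** (LOCATED-N2 as a kernel theorem): for every bounded bond field `A`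
on `ℤᵈ` the real function `t ↦ (1∕i) log V̿₁(c)[V₁ = e^{tA}]` (double bar of the typed record: symmetric (0.4) loops, single-staircase frames) is differentiable at
`t = 0` with derivative `ℓ_c = L·(Q₀A)_c + Φ(c₋)[A] − Φ(c₊)[A]`, `Φ = PhiZ` the curvature functional.  For the engine (and for print [I]'s consistently averaged
contours) Φ ≡ 0 and this is `B7Prop3Flat.hasDerivAt_mlog_dbavg_ray`. [cite: Balaban1985Averaging, (121)–(122) + (125) p.36; Balaban1987RG1, (0.4) p.253, p.254] -/
theorem hasDerivAt_mlog_dbavgZ_ray (A : SiteZ d → Fin d → 𝔸) {M : ℝ} (hM0 : 0 ≤ M) (hM : ∀ x κ, ‖A x κ‖ ≤ M)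
    (L : ℕ) (hL : 1 ≤ L) (q : SiteZ d) (κ : Fin d) :
    HasDerivAt (fun t : ℝ => mlog ((dbavgZ L (expCfg (t • A)) q κ : 𝔸ˣ) : 𝔸))
      (linQZ L A q κ + PhiZ L A q - PhiZ L A (q + (L : ℤ) • e κ)) 0 := by
  set N : ℝ := ((2 * (d * L) + L + L : ℕ) : ℝ) with hN
  have hN0 : 0 ≤ N := by positivity
  rw [hasDerivAt_iff_isLittleO_nhds_zero]
  have h0 : mlog ((dbavgZ L (expCfg ((0 : ℝ) • A)) q κ : 𝔸ˣ) : 𝔸) = 0 := by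
    rw [zero_smul]; exact mlog_dbavgZ_zero L hL q κ
  refine (Asymptotics.IsBigO.of_bound (555 * (N * M) ^ 2) ?_).trans_isLittleO
    (Asymptotics.isLittleO_pow_id (one_lt_two))
  rw [Metric.eventually_nhds_iff]
  refine ⟨1 / (64 * (N * M + 1)), by positivity, fun t ht => ?_⟩
  rw [dist_zero_right, Real.norm_eq_abs] at ht
  have hsmall : N * (M * |t|) ≤ 1 / 64 := by
    have hpos : (0 : ℝ) < 64 * (N * M + 1) := by positivity
    have h1 : |t| * (64 * (N * M + 1)) ≤ 1 := by
      have := mul_le_mul_of_nonneg_right ht.le hpos.le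
      rwa [one_div, inv_mul_cancel₀ hpos.ne'] at this
    nlinarith [abs_nonneg t, mul_nonneg hN0 hM0]
  have h := mlog_dbavgZ_sub_linZ_le_of_bound A hM0 hM L hL q κ t hsmall
  rw [zero_add, h0, sub_zero, norm_pow, Real.norm_eq_abs, sq_abs]
  exact h

end Estimates

end Literature.MathematicalPhysics.QuantumFieldTheory.Balaban1983to89.B7Prop3FlatRec
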